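import Summits.BirchSwinnertonDyer.BirchSwinnertonDyer.Theorems.EisensteinPrimesMazurMCOnX1RankZeroSecondDescent
import Literature.NumberTheory.EllipticCurves.Rank1Residual.Typed.HigherDescentCertificate
import HarnessLib

/-!
# The Cassels–Tate / descent road as a DECISION PROCEDURE: `BSD(E,p)` (and, on row A3, Mazur's main conjecture at
# the pair) is EQUIVALENT to one finite descent bit, and the wrong bit REFUTES it (cell `bsd-eis`, seat
# `bsd-eis-k5-p4` g0, lens «Cassels–Tate / isogeny-descent decision road … decides each cell either way»; crux 5
# `MazurMCOnX1RankZero` stmt-BirchSwinnertonDyer-19035 — THEOREMS ONLY, class-free engines + X1 instances; nothing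
# booked, no label or count moves, the crux stays OPEN)

HONEST FRAMING (cell `bsd-eis`, run/shared/lean/pub/bsd-eis/). The cell's per-pair roads on rows A3/A10 (and, through
the twist partner, B11) are ONE-WAY doors: PUBLISHED facts + a READ certificate ⇒ `BSDp W p`
(`Typed/CasselsLowerBound.lean`, `…SecondDescent.lean`, `Typed/HigherDescentCertificate.lean`). This file records the
OTHER direction, which is what makes the finite computation a DECISION and not merely a sufficient test — every
theorem below is bookkeeping around Cassels 1962 (the order of a finite `Ш` is a square; tree fact
`exists_casselsTate_pairing`, bsd.S18), Gross–Zagier–Kolyvagin (`rank_eq_analyticRank_of_analyticRank_le_one`,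
bsd.S17: `Ш` finite in analytic rank `≤ 1`) and, at rank `0`, Wuthrich 2014 Prop. 21 (`sha_dvd_analyticSha`: the
upper half at an odd non-additive prime with Borel-or-surjective image). NO new mathematics and no claim about any
curve: a `BSDp`-refuting bit has never been observed; the point is that the census instruments COULD refute.

* §1 (any pair of analytic rank `≤ 1`; GZK, + CT for parity) NECESSITY: `BSD(E,p)` forces
  `ord_p #Ш_an = ord_p #Ш` (`padicValRat_shaAn_eq_padicValNat_shaOrder_of_bsdp`), hence `ord_p #Ш_an` EVEN
  (`even_padicValRat_shaAn_of_bsdp`) — so an ODD `ord_p #Ш_an` REFUTES `BSD(E,p)`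
  (`not_bsdp_of_odd_padicValRat_shaAn`: the "is `#Ш_an` a square?" check every census row passes is a
  NECESSARY condition, not folklore comfort), and `ord_p #Ш_an > 0` forces `Ш(E)[p] ≠ 0`
  (`exists_sha_torsion_of_bsdp_of_padicValRat_shaAn_pos`).
* §2 (any pair of analytic rank `≤ 1`; GZK only) THE DECISION from the native higher-descent output: given
  stabilisation `Ш[p^{k+1}] = Ш[p^k]` and the count `#Ш[p^k] = p^m`, `BSD(E,p) ↔ ord_p #Ш_an = m`
  (`bsdp_iff_padicValRat_shaAn_eq_of_stable`) and `ord_p #Ш_an ≠ m → ¬ BSD(E,p)` (`not_bsdp_of_stable_of_ne`).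
* §3 (rank `0`, Wuthrich-eligible `p`) THE LAYERED DECISION: `ord_p #Ш_an = 2k ⇒ (BSD(E,p) ↔ p^{2k-1} ∣ #Ш)`
  (`bsdp_iff_pow_pred_dvd_shaOrder`); first layer `ord_p #Ш_an = 2 ⇒ (BSD(E,p) ↔ Ш[p] ≠ 0)`; second layer
  `ord_p #Ш_an = 4 ∧ #Ш[p] = p² ⇒ (BSD(E,p) ↔ Ш[p] ∩ pШ ≠ 0)` — the bit the van Beek–Fisher computation of the
  Cassels–Tate pairing on `S^{(φ̂)}` reads at `p = 3` (`ctp3iso` verdict DEGENERATE ⇒ `≠ 0`; NONDEG would give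
  `Ш[p²] = Ш[p]`, i.e. `ord_p #Ш = 2 ≠ 4`: `not_bsdp_of_torsionBy_inf_range_eq_bot`).
* §4 row A3 (class X1, `r_an = 0`): the same with MAZUR'S MAIN CONJECTURE `Rank1ResidualX1Defs.MazurMainConjecture W p`
  — the conclusion of crux 5 at the pair — on the left (`Rank1ResidualX1Converse.mazurMainConjecture_iff_bsdp`:
  Wuthrich Thm. 16 + Greenberg Thm. 4.1 + Prop. 21, all PUBLISHED): at `296450jp`-shaped cells
  (`#Ш_an(E₂) = 81`, `#Ш(E₂)[3] = 9`) Mazur's conjecture at `(E₂, 3)` is TRUE iff `Ш(E₂)[3] ∩ 3Ш(E₂) ≠ 0` and FALSE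
  iff the Cassels–Tate pairing on `Ш(E₂)[3]` is non-degenerate — «either way».

What this is NOT: not a class theorem; not a new certificate (the READ data are the cell's: `#Ш_an` by two engines,
first-descent dimensions, the `ctp3iso` / `desc3borel` bit); not a claim that any instrument disagrees with BSD.

References: [Cassels1962ArithmeticIV]; [SilvermanAEC2009] Thm. X.4.2, X.4.14; [MilneADT2006] Thm. I.6.13;
[Wuthrich2014] Thm. 16 (p. 397), Prop. 21 (p. 400); [GreenbergLNM1716] Thm. 4.1; [Miller2011LMS] §1, Def. 1.1;
van Beek–Fisher, Acta Arith. 185 (2018) 367–396; Schaefer–Stoll, Trans. AMS 356 (2004).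
-/

set_option autoImplicit false
set_option linter.dupNamespace false

noncomputable section

open scoped Classical AddSubgroup

open WeierstrassCurve Literature.NumberTheory.EllipticCurves
  Literature.NumberTheory.EllipticCurves.ModularForms
  Literature.NumberTheory.EllipticCurves.Wuthrich2014
  Literature.NumberTheory.EllipticCurves.Rank1Residual
  Literature.NumberTheory.EllipticCurves.Rank1Residual.Typed
  Literature.GroupTheory.FiniteAbelian
  Summit.BirchSwinnertonDyer.BirchSwinnertonDyer.Theorems.EisensteinPrimesMazurMCOnX1RankZeroSecondDescentAlgebra
  Summit.BirchSwinnertonDyer.BirchSwinnertonDyer.Theorems.EisensteinPrimesMazurMCOnX1RankZeroSecondDescent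

namespace Summit.BirchSwinnertonDyer.BirchSwinnertonDyer.Theorems.CasselsTateDecision

variable (W : WeierstrassCurve ℚ) [W.IsElliptic] (p : ℕ) [Fact p.Prime]

/-! ### §1 Necessity in analytic rank `≤ 1` (GZK, + Cassels–Tate for parity) -/

section Necessity

/-- **`BSD(E,p)` pins `ord_p #Ш_an`:** in analytic rank `≤ 1` (`Ш` finite by Gross–Zagier–Kolyvagin `hGZK`),
`BSDp W p` and `#Ш(E)_an = q` give `ord_p q = ord_p #Ш(E)` (Miller's last clause read backwards; the rational `q`
with `shaAn W = q` is unique). [cite: Miller2011LMS, §1 and Def. 1.1] -/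
theorem padicValRat_shaAn_eq_padicValNat_shaOrder_of_bsdp (hGZK : rank_eq_analyticRank_of_analyticRank_le_one)
    (hr : W.analyticRank ≤ 1) (h : BSDp W p) {q : ℚ} (hq : shaAn W = (q : ℂ)) :
    padicValRat p q = padicValNat p W.shaOrder := by
  haveI : Finite W.sha := (hGZK W hr).2
  obtain ⟨q', hq', hv'⟩ := missingPPartAt_of_bsdp W p h
  have hqq : q' = q := by exact_mod_cast hq'.symm.trans hq
  subst hqq
  exact hv'

omit [W.IsElliptic] in
/-- **Cassels: `ord_p #Ш(E)` is EVEN** for a finite `Ш(E/ℚ)` (`#Ш` is a perfect square under the alternating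
non-degenerate Cassels–Tate pairing, `hCT` = bsd.S18, `isSquare_shaOrder_of_casselsTate`).
[cite: Cassels1962ArithmeticIV, Thm. 1.1] [cite: SilvermanAEC2009, Thm. X.4.14] -/
theorem even_padicValNat_shaOrder_of_casselsTate [W.IsElliptic] (hCT : exists_casselsTate_pairing (K := ℚ))
    (hfin : W.ShaFinite) : Even (padicValNat p W.shaOrder) := by
  obtain ⟨r, hr⟩ := isSquare_shaOrder_of_casselsTate hCT W hfin
  have hr0 : r ≠ 0 := by
    intro h0
    exact (WeierstrassCurve.shaOrder_pos W hfin).ne' (by rw [hr, h0, mul_zero])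
  rw [hr, padicValNat.mul hr0 hr0]
  exact ⟨_, rfl⟩

/-- **`BSD(E,p)` forces `ord_p #Ш_an` to be EVEN** (analytic rank `≤ 1`): §1's two lemmas.
[cite: SilvermanAEC2009, Thm. X.4.14] [cite: Miller2011LMS, §1 and Def. 1.1] -/
theorem even_padicValRat_shaAn_of_bsdp (hCT : exists_casselsTate_pairing (K := ℚ))
    (hGZK : rank_eq_analyticRank_of_analyticRank_le_one) (hr : W.analyticRank ≤ 1) (h : BSDp W p)
    {q : ℚ} (hq : shaAn W = (q : ℂ)) : Even (padicValRat p q) := by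
  rw [padicValRat_shaAn_eq_padicValNat_shaOrder_of_bsdp W p hGZK hr h hq]
  exact (Int.even_coe_nat _).mpr (even_padicValNat_shaOrder_of_casselsTate W p hCT (hGZK W hr).2)

/-- **REFUTATION SHAPE (parity): an ODD `ord_p #Ш(E)_an` refutes `BSD(E,p)`** in analytic rank `≤ 1`
(Cassels–Tate + Gross–Zagier–Kolyvagin only). The squareness of `#Ш_an` that every census engine checks is therefore a
NECESSARY condition of `BSD(E,p)` at each `p`, and a row failing it would be a counterexample. No such row exists in
the cell's tables; nothing is claimed about any curve. [cite: SilvermanAEC2009, Thm. X.4.14] [cite: Miller2011LMS, Def. 1.1] -/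
theorem not_bsdp_of_odd_padicValRat_shaAn (hCT : exists_casselsTate_pairing (K := ℚ))
    (hGZK : rank_eq_analyticRank_of_analyticRank_le_one) (hr : W.analyticRank ≤ 1)
    {q : ℚ} (hq : shaAn W = (q : ℂ)) (hodd : Odd (padicValRat p q)) : ¬ BSDp W p :=
  fun h ↦ Int.not_odd_iff_even.mpr (even_padicValRat_shaAn_of_bsdp W p hCT hGZK hr h hq) hodd

/-- **`BSD(E,p)` with `ord_p #Ш_an > 0` forces `Ш(E)[p] ≠ 0`** (analytic rank `≤ 1`; Cauchy's theorem in the finite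
group `Ш`): the first-descent certificate the doors READ is also NECESSARY. [cite: Miller2011LMS, §1 and Def. 1.1] -/
theorem exists_sha_torsion_of_bsdp_of_padicValRat_shaAn_pos (hGZK : rank_eq_analyticRank_of_analyticRank_le_one)
    (hr : W.analyticRank ≤ 1) (h : BSDp W p) {q : ℚ} (hq : shaAn W = (q : ℂ)) (hpos : 0 < padicValRat p q) :
    ∃ x : W.sha, x ≠ 0 ∧ p • x = 0 := by
  have hfin : W.ShaFinite := (hGZK W hr).2
  haveI : Finite W.sha := hfin
  have heq := padicValRat_shaAn_eq_padicValNat_shaOrder_of_bsdp W p hGZK hr h hq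
  have h1 : 1 ≤ padicValNat p W.shaOrder := by
    have : (0 : ℤ) < padicValNat p W.shaOrder := by rwa [heq] at hpos
    exact_mod_cast this
  have hdvd : p ∣ Nat.card W.sha := by
    have h' := (padicValNat_dvd_iff_le (WeierstrassCurve.shaOrder_pos W hfin).ne').mpr h1
    rwa [pow_one] at h'
  obtain ⟨x, hx⟩ := exists_prime_addOrderOf_dvd_card' (G := W.sha) p hdvd
  refine ⟨x, ?_, ?_⟩
  · intro h0
    rw [h0, addOrderOf_zero] at hx
    exact (Fact.out : p.Prime).one_lt.ne hx
  · rw [← hx]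
    exact addOrderOf_nsmul_eq_zero x

/-- **`BSD(E,p)` with `ord_p #Ш_an = n` forces `p^n ∣ #Ш(E)`** (analytic rank `≤ 1`). [cite: Miller2011LMS, Def. 1.1] -/
theorem pow_dvd_shaOrder_of_bsdp (hGZK : rank_eq_analyticRank_of_analyticRank_le_one)
    (hr : W.analyticRank ≤ 1) (h : BSDp W p) {q : ℚ} (hq : shaAn W = (q : ℂ)) {n : ℕ}
    (hv : padicValRat p q = n) : p ^ n ∣ W.shaOrder := by
  have hfin : W.ShaFinite := (hGZK W hr).2
  have heq := padicValRat_shaAn_eq_padicValNat_shaOrder_of_bsdp W p hGZK hr h hq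
  have hn : padicValNat p W.shaOrder = n := by exact_mod_cast heq.symm.trans hv
  exact (padicValNat_dvd_iff_le (WeierstrassCurve.shaOrder_pos W hfin).ne').mpr hn.ge

end Necessity

/-! ### §2 The decision from the native higher-descent output (analytic rank `≤ 1`; GZK only) -/

section Stable

/-- **DECISION (native shape).** In analytic rank `≤ 1`, once a tower of descents has certified stabilisation
`Ш(E)[p^{k+1}] = Ш(E)[p^k]` (`hstab`) and the count `#Ш(E)[p^k] = p^m` (`hcard`) — together they say
`ord_p #Ш(E) = m` (`Typed.padicValNat_shaOrder_eq_of_stable`) — `BSD(E,p)` holds IF AND ONLY IF `ord_p #Ш(E)_an = m`.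
(⇐) is `Typed.bsdp_of_stable`; (⇒) is §1. Gross–Zagier–Kolyvagin is the only named input.
[cite: SilvermanAEC2009, Thm. X.4.2] [cite: Miller2011LMS, §1 and Def. 1.1] -/
theorem bsdp_iff_padicValRat_shaAn_eq_of_stable (hGZK : rank_eq_analyticRank_of_analyticRank_le_one)
    (hr : W.analyticRank ≤ 1) {k m : ℕ}
    (hstab : ∀ x : W.sha, p ^ (k + 1) • x = 0 → p ^ k • x = 0)
    (hcard : Nat.card (AddSubgroup.torsionBy W.sha (p ^ k : ℕ)) = p ^ m)
    {q : ℚ} (hq : shaAn W = (q : ℂ)) : BSDp W p ↔ padicValRat p q = m := by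
  refine ⟨fun h ↦ ?_, fun hv ↦ bsdp_of_stable W p hGZK hr hstab hcard hq hv⟩
  rw [padicValRat_shaAn_eq_padicValNat_shaOrder_of_bsdp W p hGZK hr h hq,
    padicValNat_shaOrder_eq_of_stable W p (hGZK W hr).2 hstab hcard]

/-- **REFUTATION SHAPE (native): a stabilised descent count that disagrees with `ord_p #Ш_an` refutes `BSD(E,p)`.**
[cite: SilvermanAEC2009, Thm. X.4.2] [cite: Miller2011LMS, §1 and Def. 1.1] -/
theorem not_bsdp_of_stable_of_ne (hGZK : rank_eq_analyticRank_of_analyticRank_le_one)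
    (hr : W.analyticRank ≤ 1) {k m : ℕ}
    (hstab : ∀ x : W.sha, p ^ (k + 1) • x = 0 → p ^ k • x = 0)
    (hcard : Nat.card (AddSubgroup.torsionBy W.sha (p ^ k : ℕ)) = p ^ m)
    {q : ℚ} (hq : shaAn W = (q : ℂ)) (hne : padicValRat p q ≠ m) : ¬ BSDp W p :=
  fun h ↦ hne ((bsdp_iff_padicValRat_shaAn_eq_of_stable W p hGZK hr hstab hcard hq).mp h)

omit [W.IsElliptic] [Fact p.Prime] in
/-- **Dictionary: `Ш[p] ∩ pШ = 0` (no element of `Ш[p]` is a `p`-th multiple — the READING of "the Cassels–Tate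
pairing restricted to `Ш[p]` is non-degenerate") is stabilisation at the first level, `Ш[p²] = Ш[p]`.** [folklore] -/
theorem sha_stable_one_of_torsionBy_inf_range_eq_bot
    (hbot : W.sha[(p : ℤ)] ⊓ (nsmulAddMonoidHom (α := W.sha) p).range = ⊥) :
    ∀ x : W.sha, p ^ (1 + 1) • x = 0 → p ^ 1 • x = 0 := by
  intro x hx
  rw [pow_one]
  have hmem : p • x ∈ W.sha[(p : ℤ)] ⊓ (nsmulAddMonoidHom (α := W.sha) p).range := by
    refine AddSubgroup.mem_inf.mpr ⟨AddSubgroup.torsionBy.nsmul_iff.mpr ?_, ⟨x, rfl⟩⟩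
    rw [← mul_nsmul', ← pow_two]
    exact hx
  rw [hbot, AddSubgroup.mem_bot] at hmem
  exact hmem

/-- **REFUTATION SHAPE (second layer): `ord_p #Ш_an = 4`, `#Ш[p] = p²` and `Ш[p] ∩ pШ = 0` refute `BSD(E,p)`**
(analytic rank `≤ 1`): then `Ш[p²] = Ш[p]`, so `ord_p #Ш = 2 ≠ 4`. This is the «other way» of the `296450jp`-shaped
A3 cells (`#Ш_an(E₂) = 81`, `dim Ш(E₂)[3] = 2`): a NON-DEGENERATE Cassels–Tate pairing on `Ш(E₂)[3]` would have been
a counterexample to `BSD(E₂,3)`; the instrument read DEGENERATE. [cite: SilvermanAEC2009, Thm. X.4.2]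
[cite: Miller2011LMS, §1 and Def. 1.1] -/
theorem not_bsdp_of_torsionBy_inf_range_eq_bot (hGZK : rank_eq_analyticRank_of_analyticRank_le_one)
    (hr : W.analyticRank ≤ 1)
    (hbot : W.sha[(p : ℤ)] ⊓ (nsmulAddMonoidHom (α := W.sha) p).range = ⊥)
    (hcard : Nat.card (W.sha[(p : ℤ)]) = p ^ 2)
    {q : ℚ} (hq : shaAn W = (q : ℂ)) (hv : padicValRat p q = 4) : ¬ BSDp W p := by
  have hcard' : Nat.card (AddSubgroup.torsionBy W.sha (p ^ 1 : ℕ)) = p ^ 2 := by rwa [pow_one]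
  refine not_bsdp_of_stable_of_ne W p hGZK hr (sha_stable_one_of_torsionBy_inf_range_eq_bot W p hbot) hcard' hq ?_
  rw [hv]; norm_num

end Stable

/-! ### §3 The layered decision at a rank-`0` pair where Wuthrich's upper half applies -/

section RankZero

variable [W.IsGloballyMinimal]

/-- **LAYER-`k` DECISION (rank `0`, odd non-additive `p`, Borel-or-surjective image): `ord_p #Ш(E)_an = 2k ⇒
(BSD(E,p) ↔ p^{2k-1} ∣ #Ш(E))`.** (⇐) Wuthrich Prop. 21 + Cassels–Tate squareness + the certificate
(`Typed.bsdp_of_wuthrich_of_casselsTate_of_pow_dvd`); (⇒) §1 (`p^{2k} ∣ #Ш`). The certificate is one power of `p`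
cheaper than the conclusion — that is Cassels' contribution. [cite: Wuthrich2014, Prop. 21 (p. 400)]
[cite: SilvermanAEC2009, Thm. X.4.14] [cite: Miller2011LMS, §1 and Def. 1.1] -/
theorem bsdp_iff_pow_pred_dvd_shaOrder (hCT : exists_casselsTate_pairing (K := ℚ))
    (hW : sha_dvd_analyticSha) (hGZK : rank_eq_analyticRank_of_analyticRank_le_one)
    (hmod : hasEntireLFunction_rat) (hp : p ≠ 2) (hr0 : W.analyticRank = 0)
    (hadd : ¬ ((W.baseChange ℚ_[p]).minimal ℤ_[p]).HasAdditiveReduction ℤ_[p])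
    (himg : ¬ W.HasIrreducibleModPGaloisRep p ∨ W.HasSurjectiveModNGaloisRep p)
    {q : ℚ} (hq : shaAn W = (q : ℂ)) {k : ℕ} (hv : padicValRat p q = (2 * k : ℕ)) :
    BSDp W p ↔ p ^ (2 * k - 1) ∣ W.shaOrder := by
  refine ⟨fun h ↦ (pow_dvd_pow p (by omega)).trans (pow_dvd_shaOrder_of_bsdp W p hGZK (by omega) h hq hv),
    fun hdvd ↦ ?_⟩
  exact bsdp_of_wuthrich_of_casselsTate_of_pow_dvd W p hCT hW hGZK hmod hp hr0 hadd himg hq (k := k)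
    (by rw [hv]; push_cast; exact le_rfl) hdvd

/-- **FIRST-LAYER DECISION: `ord_p #Ш(E)_an = 2 ⇒ (BSD(E,p) ↔ Ш(E)[p] ≠ 0)`** (rank `0`, Wuthrich-eligible `p`).
(⇐) `Typed.bsdp_of_wuthrich_of_casselsTate_of_dvd`; (⇒) Cauchy (§1). The `#Ш_an = 9` cells of rows A3/A10 at `p = 3`:
`BSD(E,3)` there is EQUIVALENT to the first `3`-isogeny-descent bit. [cite: Wuthrich2014, Prop. 21 (p. 400)]
[cite: SilvermanAEC2009, Thm. X.4.14] [cite: Miller2011LMS, §1 and Def. 1.1] -/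
theorem bsdp_iff_exists_sha_torsion (hCT : exists_casselsTate_pairing (K := ℚ))
    (hW : sha_dvd_analyticSha) (hGZK : rank_eq_analyticRank_of_analyticRank_le_one)
    (hmod : hasEntireLFunction_rat) (hp : p ≠ 2) (hr0 : W.analyticRank = 0)
    (hadd : ¬ ((W.baseChange ℚ_[p]).minimal ℤ_[p]).HasAdditiveReduction ℤ_[p])
    (himg : ¬ W.HasIrreducibleModPGaloisRep p ∨ W.HasSurjectiveModNGaloisRep p)
    {q : ℚ} (hq : shaAn W = (q : ℂ)) (hv : padicValRat p q = 2) :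
    BSDp W p ↔ ∃ x : W.sha, x ≠ 0 ∧ p • x = 0 :=
  ⟨fun h ↦ exists_sha_torsion_of_bsdp_of_padicValRat_shaAn_pos W p hGZK (by omega) h hq (by rw [hv]; norm_num),
    fun hx ↦ bsdp_of_wuthrich_of_casselsTate_of_dvd W p hCT hW hGZK hmod hp hr0 hadd himg hq hv.le
      (dvd_shaOrder_of_exists_torsion W p hx)⟩

/-- **SECOND-LAYER DECISION: `ord_p #Ш(E)_an = 4 ∧ #Ш(E)[p] = p² ⇒ (BSD(E,p) ↔ Ш(E)[p] ∩ pШ(E) ≠ 0)`** (rank `0`,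
Wuthrich-eligible `p`). (⇐) the second-descent door (`pow_four_dvd_natCard_of_alternating_of_inf_ne_bot` with the
Cassels–Tate pairing, then layer `k = 2`); (⇒) §2: `Ш[p] ∩ pШ = 0` would give `ord_p #Ш = 2 ≠ 4`. The READ data are
the cell's CT2 currency (`#Ш_an = 81` three ways, `dim_{𝔽₃} Ш[3] = 2` from the two first-descent engines, the
`Ш[3] ∩ 3Ш` bit = the van Beek–Fisher pairing on `S^{(φ̂)}`, `ctp3iso` 0.2.2 ‖ `desc3borel` v4).
[cite: Wuthrich2014, Prop. 21 (p. 400)] [cite: SilvermanAEC2009, Thm. X.4.14] [cite: MilneADT2006, Thm. I.6.13]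
[cite: Miller2011LMS, §1 and Def. 1.1] -/
theorem bsdp_iff_torsionBy_inf_range_ne_bot (hCT : exists_casselsTate_pairing (K := ℚ))
    (hW : sha_dvd_analyticSha) (hGZK : rank_eq_analyticRank_of_analyticRank_le_one)
    (hmod : hasEntireLFunction_rat) (hp : p ≠ 2) (hr0 : W.analyticRank = 0)
    (hadd : ¬ ((W.baseChange ℚ_[p]).minimal ℤ_[p]).HasAdditiveReduction ℤ_[p])
    (himg : ¬ W.HasIrreducibleModPGaloisRep p ∨ W.HasSurjectiveModNGaloisRep p)
    {q : ℚ} (hq : shaAn W = (q : ℂ)) (hv : padicValRat p q = 4)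
    (hcard : Nat.card (W.sha[(p : ℤ)]) = p ^ 2) :
    BSDp W p ↔ W.sha[(p : ℤ)] ⊓ (nsmulAddMonoidHom (α := W.sha) p).range ≠ ⊥ := by
  refine ⟨fun h hbot ↦ not_bsdp_of_torsionBy_inf_range_eq_bot W p hGZK (by omega) hbot hcard hq hv h,
    fun hR ↦ ?_⟩
  have hfin : W.ShaFinite := (hGZK W (by omega)).2
  haveI : Finite W.sha := hfin
  obtain ⟨B, halt, hnd⟩ := exists_nondegenerate_pairing_of_casselsTate W hCT hfin
  have h4 : p ^ 4 ∣ W.shaOrder := by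
    rw [WeierstrassCurve.shaOrder]
    exact pow_four_dvd_natCard_of_alternating_of_inf_ne_bot p B halt hnd hR
  exact bsdp_of_wuthrich_of_casselsTate_of_pow_dvd W p hCT hW hGZK hmod hp hr0 hadd himg hq (k := 2)
    (by rw [hv]; norm_num) ((pow_dvd_pow p (by norm_num)).trans h4)

/-- **SECOND-LAYER DECISION in the doors' `hdiv` currency:** `ord_p #Ш(E)_an = 4`, `Ш(E)[p] ≠ 0`, `#Ш(E)[p] = p²` ⇒
(`BSD(E,p)` ↔ NOT `Ш[p²] = Ш[p]`), i.e. `BSD(E,p)` fails exactly when the first level is already stable.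
[cite: Wuthrich2014, Prop. 21 (p. 400)] [cite: SilvermanAEC2009, Thm. X.4.14] [cite: Miller2011LMS, §1 and Def. 1.1] -/
theorem bsdp_iff_not_stable_one (hCT : exists_casselsTate_pairing (K := ℚ))
    (hW : sha_dvd_analyticSha) (hGZK : rank_eq_analyticRank_of_analyticRank_le_one)
    (hmod : hasEntireLFunction_rat) (hp : p ≠ 2) (hr0 : W.analyticRank = 0)
    (hadd : ¬ ((W.baseChange ℚ_[p]).minimal ℤ_[p]).HasAdditiveReduction ℤ_[p])
    (himg : ¬ W.HasIrreducibleModPGaloisRep p ∨ W.HasSurjectiveModNGaloisRep p)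
    {q : ℚ} (hq : shaAn W = (q : ℂ)) (hv : padicValRat p q = 4)
    (hcard : Nat.card (W.sha[(p : ℤ)]) = p ^ 2) :
    BSDp W p ↔ ¬ ∀ x : W.sha, p ^ (1 + 1) • x = 0 → p ^ 1 • x = 0 := by
  have hcard' : Nat.card (AddSubgroup.torsionBy W.sha (p ^ 1 : ℕ)) = p ^ 2 := by rwa [pow_one]
  constructor
  · intro h hstab
    exact not_bsdp_of_stable_of_ne W p hGZK (by omega) hstab hcard' hq (by rw [hv]; norm_num) h
  · intro hns
    refine (bsdp_iff_torsionBy_inf_range_ne_bot W p hCT hW hGZK hmod hp hr0 hadd himg hq hv hcard).mpr ?_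
    exact fun hbot ↦ hns (sha_stable_one_of_torsionBy_inf_range_eq_bot W p hbot)

end RankZero

/-! ### §4 Row A3 (class X1, `r_an = 0`): Mazur's main conjecture at the pair DECIDED by the descent bit -/

section X1

variable [W.IsGloballyMinimal]

/-- **Crux 5's conclusion at a rank-`0` X1 pair with `ord_p #Ш_an = 2` is EQUIVALENT to `Ш(E)[p] ≠ 0`.**
`Rank1ResidualX1Defs.MazurMainConjecture W p ↔ BSDp W p` (Wuthrich Thm. 16 + Greenberg Thm. 4.1 + Prop. 21 —
`Rank1ResidualX1Converse.mazurMainConjecture_iff_bsdp`) `↔` the first-descent bit (§3; on X1 `p` is odd, good — hence not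
additive — and `E[p]` reducible — hence Borel image). All named inputs PUBLISHED; per pair, nothing booked.
[cite: GreenbergLNM1716, Thm. 4.1] [cite: Wuthrich2014, Thm. 16 (p. 397) and Prop. 21 (p. 400)]
[cite: SilvermanAEC2009, Thm. X.4.14] [cite: Miller2011LMS, Def. 1.1] -/
theorem X1.mazurMainConjecture_iff_exists_sha_torsion (hCT : exists_casselsTate_pairing (K := ℚ))
    (hW : sha_dvd_analyticSha) (hW16 : charIdeal_dvd_padicLFunction) (hGr : greenberg_charValue_rankZero)
    (hmodP : nonempty_modularParametrizationData) (hmod : hasEntireLFunction_rat)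
    (hGZK : rank_eq_analyticRank_of_analyticRank_le_one)
    (hX : ClassX1 W p) (hr0 : W.analyticRank = 0)
    {q : ℚ} (hq : shaAn W = (q : ℂ)) (hv : padicValRat p q = 2) :
    Rank1ResidualX1Defs.MazurMainConjecture W p ↔ ∃ x : W.sha, x ≠ 0 ∧ p • x = 0 := by
  have hX' := isClassX1_of_classX1 hX
  rw [Rank1ResidualX1Converse.mazurMainConjecture_iff_bsdp hW16 hGr hmodP hGZK W p hX hr0]
  exact bsdp_iff_exists_sha_torsion W p hCT hW hGZK hmod hX'.two_ne hr0 hX'.not_hasAdditiveReduction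
    (Or.inl hX'.not_hasIrreducibleModPGaloisRep) hq hv

/-- **Crux 5's conclusion at a rank-`0` X1 pair with `ord_p #Ш_an = 4` and `#Ш(E)[p] = p²` is EQUIVALENT to
`Ш(E)[p] ∩ pШ(E) ≠ 0`** — the `296450jp` / CT2 shape (certificate member `E₂`: `#Ш_an = 81`, `dim Ш(E₂)[3] = 2`): Mazur's
main conjecture at `(E₂, 3)` holds iff the Cassels–Tate pairing on `Ш(E₂)[3]` is DEGENERATE (there: identically zero),
and FAILS iff it is non-degenerate. «Either way.» [cite: GreenbergLNM1716, Thm. 4.1]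
[cite: Wuthrich2014, Thm. 16 (p. 397) and Prop. 21 (p. 400)] [cite: SilvermanAEC2009, Thm. X.4.14]
[cite: MilneADT2006, Thm. I.6.13] [cite: Miller2011LMS, Def. 1.1] -/
theorem X1.mazurMainConjecture_iff_torsionBy_inf_range_ne_bot (hCT : exists_casselsTate_pairing (K := ℚ))
    (hW : sha_dvd_analyticSha) (hW16 : charIdeal_dvd_padicLFunction) (hGr : greenberg_charValue_rankZero)
    (hmodP : nonempty_modularParametrizationData) (hmod : hasEntireLFunction_rat)
    (hGZK : rank_eq_analyticRank_of_analyticRank_le_one)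
    (hX : ClassX1 W p) (hr0 : W.analyticRank = 0)
    {q : ℚ} (hq : shaAn W = (q : ℂ)) (hv : padicValRat p q = 4)
    (hcard : Nat.card (W.sha[(p : ℤ)]) = p ^ 2) :
    Rank1ResidualX1Defs.MazurMainConjecture W p ↔
      W.sha[(p : ℤ)] ⊓ (nsmulAddMonoidHom (α := W.sha) p).range ≠ ⊥ := by
  have hX' := isClassX1_of_classX1 hX
  rw [Rank1ResidualX1Converse.mazurMainConjecture_iff_bsdp hW16 hGr hmodP hGZK W p hX hr0]
  exact bsdp_iff_torsionBy_inf_range_ne_bot W p hCT hW hGZK hmod hX'.two_ne hr0 hX'.not_hasAdditiveReduction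
    (Or.inl hX'.not_hasIrreducibleModPGaloisRep) hq hv hcard

end X1

end Summit.BirchSwinnertonDyer.BirchSwinnertonDyer.Theorems.CasselsTateDecision

end
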